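import Literature.NumberTheory.DiophantineGeometry.WeilPairingRationalTateModuleProofs
import Literature.AlgebraicGeometry.Motives.AbelianVarietyWeilPairingAlternating
import Literature.AlgebraicGeometry.Motives.AbelianVarietyWeilPairingGalois
import Literature.AlgebraicGeometry.Motives.AbelianVarietyWeilPairingRadical
import Literature.AlgebraicGeometry.Motives.AbelianVarietyTorsionPointsCountProofs
import Literature.AlgebraicGeometry.Motives.AbelianVarietyProjectiveChart
import HarnessLib

/-!
# Discharge of `weilPairing_rationalTateModule` (Milne 1986, §16; Lang VII §2; Mumford §20)

`Proofs` sibling (theorems only) of `Literature.NumberTheory.DiophantineGeometry.WeilPairingRationalTateModule`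
and of `…WeilPairingRationalTateModuleProofs`. The named fact `weilPairing_rationalTateModule` — for an
abelian variety `B` over a field `K` and a prime `p` invertible in `K`, `V_p B` carries a
non-degenerate alternating `ℚ_p`-bilinear form with `e(g x, g y) = χ_p(g) e(x, y)` for `g ∈ Γ_K`
(Milne, *Abelian varieties*, §16, Lemma 16.1–16.2; Mumford, *Abelian Varieties*, §20) — is proved
here: **`weilPairing_rationalTateModule_holds`**.

* The **algebraic layer** (passage from compatible level pairings `ē_{pᵏ}` on `B(K̄)[pᵏ]` to the
  form on `V_p B = ℚ_p ⊗ T_p B`) is `weilPairing_rationalTateModule_of_forall_levelWeilPairing` of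
  `…WeilPairingRationalTateModuleProofs`, which consumes a `LevelWeilPairing K B.geomPoints p`.
* The **geometric layer** is assembled here (§5 below) from the tree's theory of abelian varieties:
  the level pairings `ē_N^Θ(P, Q) = e_N(P, t_Q^* Θ - Θ)` of `Motives/AbelianVarietyWeilPairingLevel`
  (the Kummer pairing of `D_Q = t_Q^* Θ - Θ`, `Motives/AbelianVarietyKummerPairing`, `…WeilDivisor`:
  bimultiplicative by the theorem of the square, `μ_N`-valued, compatible in the level, and
  non-degenerate modulo `K(Θ)` by Lang VII §2 Prop. 4), which are alternating
  (`Motives/AbelianVarietyWeilPairingAlternating`: the telescoping argument of Silverman III §8 on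
  `D_P`), Galois equivariant on `B_{K̄} = B ×_K Spec K̄` for `Θ = pr₁^* Θ₀`
  (`Motives/AbelianVarietyWeilPairingGalois`: transport along `1 × Spec σ⁻¹`) and have radicals killed
  by `p^{#K(Θ)}` for `Θ₀` ample (`Motives/AbelianVarietyWeilPairingRadical`: `K(Θ)` is finite, Mumford
  §6 Application 1), are transported to the `Γ_K`-module `B.geomPoints = Additive (B.Points K̄)`
  along `B(K̄) ≃* B_{K̄}(K̄)` (`AbelianVariety.pointsMulEquiv`): `nonempty_levelWeilPairing`.
  The hypotheses of the Kummer theory of `[pᵏ]` (isogeny — flat and surjective —, and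
  `#B_{K̄}[pᵏ](K̄) = deg [pᵏ] = p^{2gk}`) are the tree's theorems `isIsogeny_zsmul_id_holds`,
  `kerRank_zsmul_id_holds`, `natCard_torsionPoints_of_isAlgClosed_holds`; the ample `Θ₀` is
  `exists_isAmple_symmetric_holds`, and `pr₁^* Θ₀` is ample because `pr₁` is affine
  (`CartierDivisor.IsAmple.pullback`).

Everything is proved; no named facts are introduced (D-0026).

## References

* [Milne1986AbelianVarieties] J. S. Milne, *Abelian varieties*, in Cornell–Silverman (eds.),
  *Arithmetic Geometry* (1986), §16 "Pairings": `ē_m` (p. 131), Lemma 16.1, `e_l`, `e_l^λ`,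
  Lemma 16.2 (PDF pp. 198–201).
* [Lang1983AbelianVarieties] S. Lang, *Abelian Varieties* (1959/1983), Ch. VII §2, Props. 2–7 and
  Thm. 5 (PDF pp. 138–142).
* [MumfordAV1970] D. Mumford, *Abelian Varieties* (1970), §6 (Applications 1–3), §20 (the
  `e_n`-pairing, Riemann forms).
* [SilvermanAEC2009] J. H. Silverman, *The Arithmetic of Elliptic Curves*, 2nd ed. (2009), III §8
  (the elliptic-curve model of the argument).
-/

noncomputable section

open scoped Classical
open scoped AddSubgroup

universe u

open AlgebraicGeometry CategoryTheory

namespace Literature.NumberTheory.DiophantineGeometry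

open Literature.NumberTheory.GaloisRepresentations
open Literature.AlgebraicGeometry.Motives (AbelianVariety)

/-! ## 5. The geometric layer: level Weil pairings of a polarisation on `B(K̄)` (Milne §16; Lang VII §2)

The level pairings `ē_{pᵏ}^Θ` of `Motives/AbelianVarietyWeilPairingLevel` on the base change
`B_{K̄} = B ×_K Spec K̄` (`AbelianVariety.baseChange`), for `Θ = pr₁^* Θ₀` the pullback of an ample
divisor `Θ₀` of `B` (`exists_isAmple_symmetric_holds`; ample by `CartierDivisor.IsAmple.pullback`,
`pr₁` being affine), transported to the `Γ_K`-module `B.geomPoints = Additive (B.Points K̄)` along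
`B(K̄) ≃* B_{K̄}(K̄)` (`AbelianVariety.pointsMulEquiv`), satisfy the axioms of `LevelWeilPairing`:
`μ`-valued and biadditive (`weilPairingLevel_pow_card_eq_one`, `weilPairingLevel_mul_left/right`),
alternating (`weilPairingLevel_self`, `Motives/AbelianVarietyWeilPairingAlternating`; `B_{K̄}(K̄)` is
divisible, `AbelianVariety.exists_zpow_eq_of_ne_zero`), Galois equivariant (`weilPairingLevel_galSmul`,
`Motives/AbelianVarietyWeilPairingGalois`), compatible in the level (`weilPairingLevel_level_mul`) and
with radicals killed by `p^{#K(Θ)}` (Lang VII §2 Prop. 4 `weilDiv_linEquiv_zero_of_forall_weilPairingLevel_eq_one`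
+ `finite_KTheta`, `Motives/AbelianVarietyWeilPairingRadical`; the hypotheses of the Kummer theory of
`[pᵏ]` — flat, surjective, `#B_{K̄}[pᵏ](K̄) = deg [pᵏ] = p^{2gk}` — from `isIsogeny_zsmul_id_holds`,
`kerRank_zsmul_id_holds`, `natCard_torsionPoints_of_isAlgClosed_holds`). Hence
`nonempty_levelWeilPairing` and, by the algebraic layer of `…WeilPairingRationalTateModuleProofs`, the
discharge `weilPairing_rationalTateModule_holds`. -/

section Geometric

open Literature.AlgebraicGeometry.Motives Literature.AlgebraicGeometry.Motives.AbelianVariety RatFn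

variable {K : Type u} [Field K] (B : AbelianVariety K) (p : ℕ) [Fact p.Prime]

/-! ### `[n]` on `B_{K̄}`: isogeny, dominance, the hypotheses of the Kummer theory -/

/-- `[n]_{B_{K̄}}` is an isogeny for `n ≠ 0` (`isIsogeny_zsmul_id_holds`). [folklore] -/
theorem isIsogeny_natCast_zsmul_baseChange (n : ℕ) (hn : n ≠ 0) :
    IsIsogeny ((n : ℤ) • 𝟙 (B.baseChange (AlgebraicClosure K))) :=
  isIsogeny_zsmul_id_holds (B.baseChange (AlgebraicClosure K)) (n : ℤ) (Int.natCast_ne_zero.mpr hn)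

/-- `[n]_{B_{K̄}}` is dominant for `n ≠ 0`. [folklore] -/
theorem isDominant_natCast_zsmul_baseChange (n : ℕ) (hn : n ≠ 0) :
    IsDominant (Hom.toSchemeHom ((n : ℤ) • 𝟙 (B.baseChange (AlgebraicClosure K)))) := by
  haveI : Surjective (Hom.toSchemeHom ((n : ℤ) • 𝟙 (B.baseChange (AlgebraicClosure K)))) :=
    (isIsogeny_natCast_zsmul_baseChange B n hn).1
  infer_instance

/-- `p` is invertible in `K̄` when it is in `K`. [folklore] -/
theorem natCast_algebraicClosure_ne_zero {n : ℕ} (hn : (n : K) ≠ 0) :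
    (n : AlgebraicClosure K) ≠ 0 := fun h => hn (by
  have h' : algebraMap K (AlgebraicClosure K) n = algebraMap K (AlgebraicClosure K) 0 := by
    rw [map_natCast, map_zero, h]
  exact (algebraMap K (AlgebraicClosure K)).injective h')

/-- **`#B_{K̄}[n](K̄) = n^{2g}`** for `n` invertible in `K` (`natCard_torsionPoints_of_isAlgClosed_holds`).
[cite: MumfordAV1970, §6 Application 3 (Proposition p. 64)] -/
theorem natCard_torsionPoints_baseChange_algebraicClosure (n : ℕ) (hn : (n : K) ≠ 0) :
    Nat.card ((B.baseChange (AlgebraicClosure K)).torsionPoints (AlgebraicClosure K) n) =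
      ((n : ℕ) : ℤ).natAbs ^ (2 * (B.baseChange (AlgebraicClosure K)).dim) :=
  natCard_torsionPoints_of_isAlgClosed_holds (A := B.baseChange (AlgebraicClosure K))
    (L := AlgebraicClosure K) (n : ℤ) (by exact_mod_cast natCast_algebraicClosure_ne_zero hn)

/-- **`B_{K̄}(K̄)` is divisible**: every point is an `n`-th power for `n ≠ 0` (Mumford §6,
Application 2; `AbelianVariety.exists_zpow_eq_of_ne_zero` transported along `B(K̄) ≃* B_{K̄}(K̄)`).
[cite: MumfordAV1970, §6 Application 2 (p. 64)] -/
theorem pow_surjective_points_baseChange (n : ℕ) (hn : n ≠ 0) :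
    Function.Surjective fun R : (B.baseChange (AlgebraicClosure K)).Points (AlgebraicClosure K) =>
      R ^ n := fun R' => by
  obtain ⟨Q, hQ⟩ := AbelianVariety.exists_zpow_eq_of_ne_zero (A := B) (n : ℤ)
    (Int.natCast_ne_zero.mpr hn) ((B.pointsMulEquiv (AlgebraicClosure K)).symm R')
  refine ⟨B.pointsMulEquiv (AlgebraicClosure K) Q, ?_⟩
  change (B.pointsMulEquiv (AlgebraicClosure K) Q) ^ n = R'
  rw [← map_pow, ← zpow_natCast, hQ, MulEquiv.apply_symm_apply]

/-! ### Torsion of `B.geomPoints` and of `B_{K̄}(K̄)` -/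

/-- `x ∈ B(K̄)[n]` (additive notation) means `x^n = 1` in `B(K̄)`. [folklore] -/
theorem toMul_pow_eq_one_of_mem_torsionBy {n : ℕ} {x : B.geomPoints}
    (hx : x ∈ (B.geomPoints)[(n : ℕ)]) :
    (Additive.toMul x : B.Points (AlgebraicClosure K)) ^ n = 1 := by
  have h : n • x = 0 := AddSubgroup.torsionBy.nsmul_iff.mp hx
  exact congrArg (fun z : B.geomPoints => (Additive.toMul z : B.Points (AlgebraicClosure K))) h

/-- Conversely `x^n = 1` gives `x ∈ B(K̄)[n]`. [folklore] -/
theorem mem_torsionBy_of_toMul_pow_eq_one {n : ℕ} {x : B.geomPoints}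
    (hx : (Additive.toMul x : B.Points (AlgebraicClosure K)) ^ n = 1) :
    x ∈ (B.geomPoints)[(n : ℕ)] := by
  refine AddSubgroup.torsionBy.nsmul_iff.mpr ?_
  apply Additive.toMul.injective
  exact hx

/-- `toMul (x + y) = toMul x * toMul y` on `B.geomPoints`. [folklore] -/
theorem toMul_add_geomPoints (x y : B.geomPoints) :
    (Additive.toMul (x + y) : B.Points (AlgebraicClosure K)) = Additive.toMul x * Additive.toMul y :=
  rfl

/-- `toMul (n • x) = (toMul x)^n` on `B.geomPoints`. [folklore] -/
theorem toMul_nsmul_geomPoints (n : ℕ) (x : B.geomPoints) :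
    (Additive.toMul (n • x) : B.Points (AlgebraicClosure K)) = Additive.toMul x ^ n :=
  toMul_nsmul _ _

/-- Transport of the level pairing across equal levels `N = N'` (the torsion subgroups and the
instances depend on the level only through its value). [folklore] -/
theorem weilPairingLevel_congr_level {A : AbelianVariety (AlgebraicClosure K)} {N N' : ℕ}
    [IsDominant (Hom.toSchemeHom ((N : ℤ) • 𝟙 A))] [IsDominant (Hom.toSchemeHom ((N' : ℤ) • 𝟙 A))]
    (h : N = N') (Θ' : CartierDivisor A.X.left) (P Q : A.torsionPoints (AlgebraicClosure K) N) :
    A.weilPairingLevel (N := N) Θ' P Q =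
      A.weilPairingLevel (N := N') Θ' ⟨P.1, h ▸ P.2⟩ ⟨Q.1, h ▸ Q.2⟩ := by
  subst h
  rfl

/-! ### The axioms of `LevelWeilPairing` for a transported level pairing -/

section Axioms

variable [hdom : ∀ k : ℕ,
  IsDominant (Hom.toSchemeHom (((p ^ k : ℕ) : ℤ) • 𝟙 (B.baseChange (AlgebraicClosure K))))]
variable (Θ : CartierDivisor (B.baseChange (AlgebraicClosure K)).X.left)
variable (e : ℕ → B.geomPoints → B.geomPoints → AlgebraicClosure K)
variable (he : ∀ (k : ℕ) (x y : B.geomPoints)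
  (hx : (Additive.toMul x : B.Points (AlgebraicClosure K)) ^ p ^ k = 1)
  (hy : (Additive.toMul y : B.Points (AlgebraicClosure K)) ^ p ^ k = 1),
  e k x y = (B.baseChange (AlgebraicClosure K)).weilPairingLevel (N := p ^ k) Θ
    (B.torsionPt (AlgebraicClosure K) hx) (B.torsionPt (AlgebraicClosure K) hy))

omit [Fact p.Prime] in
/-- **There is a level pairing function** `e k x y = ē_{pᵏ}^Θ(x, y)` on `pᵏ`-torsion points of
`B(K̄)` (junk value `1` elsewhere). [folklore] -/
theorem exists_levelFun :
    ∃ e : ℕ → B.geomPoints → B.geomPoints → AlgebraicClosure K, ∀ (k : ℕ) (x y : B.geomPoints)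
      (hx : (Additive.toMul x : B.Points (AlgebraicClosure K)) ^ p ^ k = 1)
      (hy : (Additive.toMul y : B.Points (AlgebraicClosure K)) ^ p ^ k = 1),
      e k x y = (B.baseChange (AlgebraicClosure K)).weilPairingLevel (N := p ^ k) Θ
        (B.torsionPt (AlgebraicClosure K) hx) (B.torsionPt (AlgebraicClosure K) hy) := by
  classical
  refine ⟨fun k x y => if h : (Additive.toMul x : B.Points (AlgebraicClosure K)) ^ p ^ k = 1 ∧
      (Additive.toMul y : B.Points (AlgebraicClosure K)) ^ p ^ k = 1 then
    (B.baseChange (AlgebraicClosure K)).weilPairingLevel (N := p ^ k) Θ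
      (B.torsionPt (AlgebraicClosure K) h.1) (B.torsionPt (AlgebraicClosure K) h.2) else 1,
    fun k x y hx hy => ?_⟩
  exact dif_pos (And.intro hx hy)

include he

omit [Fact p.Prime] in
/-- `e(x, y)^{pᵏ} = 1` (`weilPairingLevel_pow_card_eq_one`). [cite: Milne1986AbelianVarieties, §16 (p. 132)] -/
theorem levelFun_pow_eq_one (k : ℕ) (x y : B.geomPoints) (hx : x ∈ (B.geomPoints)[(p ^ k : ℕ)])
    (hy : y ∈ (B.geomPoints)[(p ^ k : ℕ)]) : e k x y ^ p ^ k = 1 := by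
  rw [he k x y (toMul_pow_eq_one_of_mem_torsionBy B hx) (toMul_pow_eq_one_of_mem_torsionBy B hy)]
  exact weilPairingLevel_pow_card_eq_one Θ _ _

omit [Fact p.Prime] in
/-- Additive in the first variable (`weilPairingLevel_mul_left`). [cite: Lang1983AbelianVarieties, Ch. VII §2 Prop. 3] -/
theorem levelFun_add_left (k : ℕ) (x x' y : B.geomPoints) (hx : x ∈ (B.geomPoints)[(p ^ k : ℕ)])
    (hx' : x' ∈ (B.geomPoints)[(p ^ k : ℕ)]) (hy : y ∈ (B.geomPoints)[(p ^ k : ℕ)]) :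
    e k (x + x') y = e k x y * e k x' y := by
  have hxx' : x + x' ∈ (B.geomPoints)[(p ^ k : ℕ)] := add_mem hx hx'
  rw [he k _ _ (toMul_pow_eq_one_of_mem_torsionBy B hxx') (toMul_pow_eq_one_of_mem_torsionBy B hy),
    he k _ _ (toMul_pow_eq_one_of_mem_torsionBy B hx) (toMul_pow_eq_one_of_mem_torsionBy B hy),
    he k _ _ (toMul_pow_eq_one_of_mem_torsionBy B hx') (toMul_pow_eq_one_of_mem_torsionBy B hy),
    ← weilPairingLevel_mul_left]
  congr 1
  exact Subtype.ext (by
    change B.pointsMulEquiv (AlgebraicClosure K) (Additive.toMul (x + x')) =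
      B.pointsMulEquiv (AlgebraicClosure K) (Additive.toMul x) *
        B.pointsMulEquiv (AlgebraicClosure K) (Additive.toMul x')
    rw [toMul_add_geomPoints, map_mul])

omit [Fact p.Prime] in
/-- Additive in the second variable (`weilPairingLevel_mul_right`). [cite: Lang1983AbelianVarieties, Ch. VII §2 Prop. 3] -/
theorem levelFun_add_right (k : ℕ) (x y y' : B.geomPoints) (hx : x ∈ (B.geomPoints)[(p ^ k : ℕ)])
    (hy : y ∈ (B.geomPoints)[(p ^ k : ℕ)]) (hy' : y' ∈ (B.geomPoints)[(p ^ k : ℕ)]) :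
    e k x (y + y') = e k x y * e k x y' := by
  have hyy' : y + y' ∈ (B.geomPoints)[(p ^ k : ℕ)] := add_mem hy hy'
  rw [he k _ _ (toMul_pow_eq_one_of_mem_torsionBy B hx) (toMul_pow_eq_one_of_mem_torsionBy B hyy'),
    he k _ _ (toMul_pow_eq_one_of_mem_torsionBy B hx) (toMul_pow_eq_one_of_mem_torsionBy B hy),
    he k _ _ (toMul_pow_eq_one_of_mem_torsionBy B hx) (toMul_pow_eq_one_of_mem_torsionBy B hy'),
    ← weilPairingLevel_mul_right]
  congr 1
  exact Subtype.ext (by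
    change B.pointsMulEquiv (AlgebraicClosure K) (Additive.toMul (y + y')) =
      B.pointsMulEquiv (AlgebraicClosure K) (Additive.toMul y) *
        B.pointsMulEquiv (AlgebraicClosure K) (Additive.toMul y')
    rw [toMul_add_geomPoints, map_mul])

/-- **Alternating** (`weilPairingLevel_self`, `Motives/AbelianVarietyWeilPairingAlternating`;
`B_{K̄}(K̄)` is divisible). [cite: Lang1983AbelianVarieties, Ch. VII §2 Thm. 5 (i)] -/
theorem levelFun_self_eq_one (k : ℕ) (x : B.geomPoints) (hx : x ∈ (B.geomPoints)[(p ^ k : ℕ)]) :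
    e k x x = 1 := by
  rw [he k x x (toMul_pow_eq_one_of_mem_torsionBy B hx) (toMul_pow_eq_one_of_mem_torsionBy B hx)]
  exact weilPairingLevel_self
    (pow_surjective_points_baseChange B (p ^ k) (pow_ne_zero k (Fact.out : p.Prime).ne_zero)) Θ _

omit [Fact p.Prime] in
/-- **Galois equivariant** for a Galois-invariant `Θ` (`weilPairingLevel_galSmul`,
`Motives/AbelianVarietyWeilPairingGalois`). [cite: Milne1986AbelianVarieties, §16 (p. 131, the pairings ē_m)] -/
theorem levelFun_smul_eq
    (hΘ : ∀ τ : AlgebraicClosure K ≃ₐ[K] AlgebraicClosure K,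
      (Θ.pullback (B.galX (AlgebraicClosure K) τ)).SameDivisor Θ)
    (k : ℕ) (σ : Field.absoluteGaloisGroup K) (x y : B.geomPoints)
    (hx : x ∈ (B.geomPoints)[(p ^ k : ℕ)]) (hy : y ∈ (B.geomPoints)[(p ^ k : ℕ)]) :
    σ • e k x y = e k (σ • x) (σ • y) := by
  have hx' := toMul_pow_eq_one_of_mem_torsionBy B hx
  have hy' := toMul_pow_eq_one_of_mem_torsionBy B hy
  have hσx : (Additive.toMul (σ • x) : B.Points (AlgebraicClosure K)) ^ p ^ k = 1 :=
    B.smul_pow_eq_one (AlgebraicClosure K) (Field.absoluteGaloisGroup.toAlgEquiv K σ) hx'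
  have hσy : (Additive.toMul (σ • y) : B.Points (AlgebraicClosure K)) ^ p ^ k = 1 :=
    B.smul_pow_eq_one (AlgebraicClosure K) (Field.absoluteGaloisGroup.toAlgEquiv K σ) hy'
  rw [he k x y hx' hy', he k (σ • x) (σ • y) hσx hσy, Field.absoluteGaloisGroup.smul_def]
  exact (B.weilPairingLevel_galSmul (AlgebraicClosure K) Θ hΘ
    (Field.absoluteGaloisGroup.toAlgEquiv K σ) hx' hy').symm

omit [Fact p.Prime] in
/-- **Compatible in the level**: `e_{k+1}(x, y)^p = e_k(p x, p y)` for `x, y ∈ B(K̄)[p^{k+1}]`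
(`weilPairingLevel_level_mul`: Lang VII §2 Prop. 5, Milne §16 Lemma 16.1, with
`e_{k+1}(x, y)^p = e_{k+1}(x, y^p)`). [cite: Milne1986AbelianVarieties, §16 Lemma 16.1] -/
theorem levelFun_pow_succ_eq (k : ℕ) (x y : B.geomPoints) (hx : x ∈ (B.geomPoints)[(p ^ (k + 1) : ℕ)])
    (hy : y ∈ (B.geomPoints)[(p ^ (k + 1) : ℕ)]) :
    e (k + 1) x y ^ p = e k (p • x) (p • y) := by
  have hx' := toMul_pow_eq_one_of_mem_torsionBy B hx
  have hy' := toMul_pow_eq_one_of_mem_torsionBy B hy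
  have hpx : (Additive.toMul (p • x) : B.Points (AlgebraicClosure K)) ^ p ^ k = 1 := by
    rw [toMul_nsmul_geomPoints, ← pow_mul, ← pow_succ', hx']
  have hpy : (Additive.toMul (p • y) : B.Points (AlgebraicClosure K)) ^ p ^ k = 1 := by
    rw [toMul_nsmul_geomPoints, ← pow_mul, ← pow_succ', hy']
  rw [he (k + 1) x y hx' hy', he k (p • x) (p • y) hpx hpy, ← weilPairingLevel_pow_right]
  -- pass from level `p^(k+1)` to level `p * p^k` and apply `weilPairingLevel_level_mul`
  have hlev : p ^ (k + 1) = p * p ^ k := pow_succ' p k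
  haveI : IsDominant (Hom.toSchemeHom ((((p * p ^ k : ℕ)) : ℤ) •
      𝟙 (B.baseChange (AlgebraicClosure K)))) := by rw [← hlev]; exact hdom (k + 1)
  haveI : IsDominant (Hom.toSchemeHom (((p : ℕ) : ℤ) • 𝟙 (B.baseChange (AlgebraicClosure K)))) := by
    have h1 := hdom 1
    rwa [pow_one] at h1
  rw [weilPairingLevel_congr_level hlev]
  have hQ : (B.pointsMulEquiv (AlgebraicClosure K) (Additive.toMul y)) ^ p ∈
      (B.baseChange (AlgebraicClosure K)).torsionPoints (AlgebraicClosure K) (p ^ k : ℕ) := by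
    rw [mem_torsionPoints_iff, zpow_natCast, ← map_pow, ← map_pow, ← toMul_nsmul_geomPoints, hpy,
      map_one]
  have h := weilPairingLevel_level_mul (A := B.baseChange (AlgebraicClosure K)) (M := p) (N := p ^ k) Θ
    ⟨B.pointsMulEquiv (AlgebraicClosure K) (Additive.toMul x), hlev ▸
      B.pointsMulEquiv_mem_torsionPoints (AlgebraicClosure K) hx'⟩
    ⟨(B.pointsMulEquiv (AlgebraicClosure K) (Additive.toMul y)) ^ p, hQ⟩
  have hX : B.torsionPt (AlgebraicClosure K) hpx =
      (B.baseChange (AlgebraicClosure K)).torsionPointsPow p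
        ⟨B.pointsMulEquiv (AlgebraicClosure K) (Additive.toMul x), hlev ▸
          B.pointsMulEquiv_mem_torsionPoints (AlgebraicClosure K) hx'⟩ := by
    apply Subtype.ext
    change B.pointsMulEquiv (AlgebraicClosure K) (Additive.toMul (p • x)) =
      (B.pointsMulEquiv (AlgebraicClosure K) (Additive.toMul x)) ^ p
    rw [toMul_nsmul_geomPoints, map_pow]
  have hY : B.torsionPt (AlgebraicClosure K) hpy =
      ⟨(B.pointsMulEquiv (AlgebraicClosure K) (Additive.toMul y)) ^ p, hQ⟩ := by
    apply Subtype.ext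
    change B.pointsMulEquiv (AlgebraicClosure K) (Additive.toMul (p • y)) =
      (B.pointsMulEquiv (AlgebraicClosure K) (Additive.toMul y)) ^ p
    rw [toMul_nsmul_geomPoints, map_pow]
  rw [hX, hY, ← h]
  rfl

/-- **The radicals are killed by `p^{#K(Θ)}`** for `Θ` ample and `p` invertible in `K`: if
`e_k(x, y) = 1` for all `y ∈ B(K̄)[pᵏ]` then, by skew-symmetry (`weilPairingLevel_swap`),
`ē_{pᵏ}^Θ(Q, x) = 1` for all `Q`, so `x ∈ K(Θ)` (Lang VII §2 Prop. 4,
`weilDiv_linEquiv_zero_of_forall_weilPairingLevel_eq_one`, whose Kummer-theory hypotheses on `[pᵏ]`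
hold: isogeny, flat, `#B_{K̄}[pᵏ](K̄) = deg [pᵏ]`) and `x^{p^{#K(Θ)}} = 1`
(`pow_prime_pow_natCard_KTheta_eq_one`, `K(Θ)` being finite for `Θ` ample, `finite_KTheta`).
[cite: Lang1983AbelianVarieties, Ch. VII §2 Prop. 4] -/
theorem levelFun_exists_radical_le (hp : (p : K) ≠ 0) (hΘ : Θ.IsAmple) :
    ∃ c : ℕ, ∀ (k : ℕ) (x : B.geomPoints), x ∈ (B.geomPoints)[(p ^ k : ℕ)] →
      (∀ y ∈ (B.geomPoints)[(p ^ k : ℕ)], e k x y = 1) →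
        p ^ c • x = 0 := by
  refine ⟨Nat.card ((B.baseChange (AlgebraicClosure K)).KTheta Θ), fun k x hx hall => ?_⟩
  have hpr : p.Prime := Fact.out
  have hN0 : p ^ k ≠ 0 := pow_ne_zero k hpr.ne_zero
  have hNK : ((p ^ k : ℕ) : K) ≠ 0 := by rw [Nat.cast_pow]; exact pow_ne_zero k hp
  have hx' := toMul_pow_eq_one_of_mem_torsionBy B hx
  -- the Kummer-theory hypotheses on `[p^k]_{B_{K̄}}`
  have hiso : IsIsogeny (((p ^ k : ℕ) : ℤ) • 𝟙 (B.baseChange (AlgebraicClosure K))) := isIsogeny_natCast_zsmul_baseChange B (p ^ k) hN0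
  haveI : Surjective (Hom.toSchemeHom (((p ^ k : ℕ) : ℤ) • 𝟙 (B.baseChange (AlgebraicClosure K)))) := hiso.1
  haveI : IsFinite (Hom.toSchemeHom (((p ^ k : ℕ) : ℤ) • 𝟙 (B.baseChange (AlgebraicClosure K)))) := hiso.2
  haveI : Flat (Hom.toSchemeHom (((p ^ k : ℕ) : ℤ) • 𝟙 (B.baseChange (AlgebraicClosure K)))) := IsIsogeny.flat_toSchemeHom_holds hiso
  have hcard : Nat.card ((B.baseChange (AlgebraicClosure K)).torsionPoints (AlgebraicClosure K) (p ^ k : ℕ)) =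
      (((p ^ k : ℕ)) : ℤ).natAbs ^ (2 * (B.baseChange (AlgebraicClosure K)).dim) :=
    natCard_torsionPoints_baseChange_algebraicClosure B (p ^ k) hNK
  haveI : Finite ((B.baseChange (AlgebraicClosure K)).torsionPoints (AlgebraicClosure K) (p ^ k : ℕ)) :=
    Nat.finite_of_card_ne_zero (by
      rw [hcard, Int.natAbs_natCast]
      exact pow_ne_zero _ hN0)
  have hdeg : Module.finrank (B.baseChange (AlgebraicClosure K)).X.left.functionField
      (FunctionFieldOver (Hom.toSchemeHom (((p ^ k : ℕ) : ℤ) • 𝟙 (B.baseChange (AlgebraicClosure K))))) =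
        Nat.card ((B.baseChange (AlgebraicClosure K)).torsionPoints (AlgebraicClosure K) (p ^ k : ℕ)) := by
    rw [← hiso.kerRank_eq_finrank_functionFieldOver,
      kerRank_zsmul_id_holds (B.baseChange (AlgebraicClosure K)) ((p ^ k : ℕ) : ℤ) (Int.natCast_ne_zero.mpr hN0), hcard]
  -- `ē(x, Q) = 1` for all `Q`, hence `ē(Q, x) = 1` for all `Q`
  have hdiv := pow_surjective_points_baseChange B (p ^ k) hN0
  have h1 : ∀ Q : (B.baseChange (AlgebraicClosure K)).torsionPoints (AlgebraicClosure K) (p ^ k : ℕ),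
      (B.baseChange (AlgebraicClosure K)).weilPairingLevel Θ Q (B.torsionPt (AlgebraicClosure K) hx') = 1 := by
    intro Q
    set y : B.geomPoints := Additive.ofMul ((B.pointsMulEquiv (AlgebraicClosure K)).symm Q.1) with hy
    have hyQ : B.pointsMulEquiv (AlgebraicClosure K) (Additive.toMul y) = Q.1 := by
      rw [hy, toMul_ofMul, MulEquiv.apply_symm_apply]
    have hy' : (Additive.toMul y : B.Points (AlgebraicClosure K)) ^ p ^ k = 1 := by
      apply (B.pointsMulEquiv (AlgebraicClosure K)).injective
      rw [map_pow, map_one, hyQ, ← zpow_natCast]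
      exact (mem_torsionPoints_iff _ _).1 Q.2
    have hxy : e k x y = 1 := hall y (mem_torsionBy_of_toMul_pow_eq_one B hy')
    rw [he k x y hx' hy'] at hxy
    have hQeq : B.torsionPt (AlgebraicClosure K) hy' = Q := Subtype.ext hyQ
    rw [hQeq] at hxy
    rw [weilPairingLevel_swap Θ _ _ (hdiv _) (hdiv _), hxy, inv_one]
  -- Lang VII §2 Prop. 4: `x ∈ K(Θ)`, and `K(Θ)` is finite
  have hKT : (B.torsionPt (AlgebraicClosure K) hx').1 ∈ (B.baseChange (AlgebraicClosure K)).KTheta Θ :=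
    ((B.baseChange (AlgebraicClosure K)).mem_KTheta_iff Θ _).2 (weilDiv_linEquiv_zero_of_forall_weilPairingLevel_eq_one
      (Nat.pos_of_ne_zero hN0) hdeg Θ _ h1)
  have hpow : (B.pointsMulEquiv (AlgebraicClosure K) (Additive.toMul x)) ^ p ^ Nat.card ((B.baseChange (AlgebraicClosure K)).KTheta Θ) = 1 :=
    (B.baseChange (AlgebraicClosure K)).pow_prime_pow_natCard_KTheta_eq_one hΘ hpr (k := k)
      (by rw [← map_pow, hx', map_one]) hKT
  have hx1 : (Additive.toMul x : B.Points (AlgebraicClosure K)) ^ p ^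
      Nat.card ((B.baseChange (AlgebraicClosure K)).KTheta Θ) = 1 := by
    apply (B.pointsMulEquiv (AlgebraicClosure K)).injective
    rw [map_pow, hpow, map_one]
  apply Additive.toMul.injective
  rw [toMul_nsmul_geomPoints, hx1]
  rfl

end Axioms

/-! ### Assembly -/

/-- **The level Weil pairings of a polarisation exist on `B(K̄)`** for every abelian variety `B / K`
and every prime `p` invertible in `K`: the pairings `ē_{pᵏ}^Θ` on `B_{K̄}` for `Θ = pr₁^* Θ₀`, `Θ₀`
an ample divisor of `B` (Milne, *Abelian varieties*, §16, Lemma 16.1–16.2; Lang, *Abelian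
Varieties*, VII §2, Props. 2–7; Mumford §20), transported to `B.geomPoints` — i.e. the geometric layer
of the named fact `weilPairing_rationalTateModule`. [cite: Milne1986AbelianVarieties, §16 Lemma 16.1–16.2] -/
theorem nonempty_levelWeilPairing (hp : (p : K) ≠ 0) : Nonempty (LevelWeilPairing K B.geomPoints p) := by
  have hpr : p.Prime := Fact.out
  -- an ample divisor of `B`, pulled back to `B_{K̄}`: ample and Galois invariant
  obtain ⟨Θ₀, hΘ₀, -⟩ := exists_isAmple_symmetric_holds (A := B)
  have hΘample : (Θ₀.pullback (B.fstX (AlgebraicClosure K))).IsAmple := hΘ₀.pullback _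
  have hΘinv : ∀ τ : AlgebraicClosure K ≃ₐ[K] AlgebraicClosure K,
      ((Θ₀.pullback (B.fstX (AlgebraicClosure K))).pullback (B.galX (AlgebraicClosure K) τ)).SameDivisor
        (Θ₀.pullback (B.fstX (AlgebraicClosure K))) :=
    B.pullback_fstX_galX_sameDivisor (AlgebraicClosure K) Θ₀
  -- `[p^k]` is dominant for all `k`
  haveI hdom : ∀ k : ℕ,
      IsDominant (Hom.toSchemeHom (((p ^ k : ℕ) : ℤ) • 𝟙 (B.baseChange (AlgebraicClosure K)))) :=
    fun k => isDominant_natCast_zsmul_baseChange B (p ^ k) (pow_ne_zero k hpr.ne_zero)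
  obtain ⟨e, he⟩ := exists_levelFun B p (Θ₀.pullback (B.fstX (AlgebraicClosure K)))
  obtain ⟨c, hc⟩ := levelFun_exists_radical_le B p _ e he hp hΘample
  exact ⟨{ e := e
           pow_eq_one := levelFun_pow_eq_one B p _ e he
           add_left := levelFun_add_left B p _ e he
           add_right := levelFun_add_right B p _ e he
           self_eq_one := levelFun_self_eq_one B p _ e he
           smul_eq := levelFun_smul_eq B p _ e he hΘinv
           pow_succ_eq := levelFun_pow_succ_eq B p _ e he
           exists_radical_le := ⟨c, hc⟩ }⟩

end Geometric

/-- **Discharge of the named fact `weilPairing_rationalTateModule`** (Milne, *Abelian varieties*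
(1986), §16: the pairings `ē_m`, Lemma 16.1, `e_l`, `e_l^λ`, Lemma 16.2 (e); Lang, *Abelian
Varieties*, VII §2; Mumford, *Abelian Varieties*, §20): for an abelian variety `B` over a field `K`
and a prime `p` invertible in `K`, `V_p B` carries a non-degenerate alternating `ℚ_p`-bilinear form
with `e(g x, g y) = χ_p(g) e(x, y)` for `g ∈ Γ_K`. Geometric layer: `nonempty_levelWeilPairing`
(this file, from `Motives/AbelianVarietyWeilPairingLevel`, `…Alternating`, `…Galois`, `…Radical`);
algebraic layer: `weilPairing_rationalTateModule_of_forall_levelWeilPairing`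
(`…WeilPairingRationalTateModuleProofs`, §§1–4).
[cite: Milne1986AbelianVarieties, §16 Lemma 16.1–16.2 (PDF pp. 198–201)] -/
theorem weilPairing_rationalTateModule_holds : weilPairing_rationalTateModule :=
  weilPairing_rationalTateModule_of_forall_levelWeilPairing fun B p _ hp =>
    nonempty_levelWeilPairing B p hp

end Literature.NumberTheory.DiophantineGeometry
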